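import Summits.ABC.Analytic.RequirementsCongruence
import Literature.NumberTheory.EllipticCurves.ModularCurveNeronLatticeProofs
import Literature.NumberTheory.EllipticCurves.SzpiroFreyProofs
import Literature.NumberTheory.EllipticCurves.DegreeConjectureAbc
import Literature.NumberTheory.EllipticCurves.DegreeConjectureAbcPrelims
import Literature.NumberTheory.EllipticCurves.SzpiroBGEquivalenceProofs
import Literature.NumberTheory.EllipticCurves.SilvermanHeightLogMaxProofs
import Literature.NumberTheory.EllipticCurves.ModularCurveManinSemistableCoprimeFormProofs
import Literature.NumberTheory.EllipticCurves.NewformPeterssonSizeProofs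
import HarnessLib
import HarnessLib.Audit

/-!
# ABC — analytic / modular lens: the typed REQUIREMENTS TABLE for polynomial Szpiro over `ℚ` (III): the A0 rows are
# EXACT restatements of abc — kernel certificates

Cell `abc-an` (C1), seat `typ-1`; kernel certificates by the cell's referee `abc-an-ref-2` (REF-B F7/F9, ported to the
landed names of files I/II). HONESTY: abc is not proved by any of this. These theorems show that the SHARP rows of the table
are RESTATEMENTS of abc, not doors to it: R5♯ `HeightConjectureRat` (Frey's height conjecture with exponent `½ + ε`, all
`E/ℚ`) is EQUIVALENT to the summit statement `ABC` with NO further input (`abc_iff_heightConjectureRat`: Silverman 1986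
`max(|Δ|,|c₄|³) ≍ covol^{-6∓ε}` PROVED in the tree both ways + Bombieri–Gubler 12.5.12 PROVED); R1♯ `DegreeConjectureRat`
implies `ABC` modulo the Petersson `1−ε` fact (file II) and follows from `ABC` modulo modularity, a general-level Petersson
UPPER bound and UNIFORMLY bounded Manin constants (`degreeConjectureRat_of_abc`, Murty 1999 Thm 1 (ii) / Pasten 2024
Rem. 3.3 — the Manin constant is exactly the extra input of this direction). A-PS (`Summit.ABC.PolySzpiroRat`) is NOT abc —
«NOT abc — POLY-SZPIRO(E)»; «NOT abc; first polynomial bound would supersede Stewart–Yu's exponential» (D-0139/D-0140).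
References: [Silverman1986]; [BombieriGubler2006] Thm 12.5.12; [Frey1989]; [MaiMurty1994]; [MurtyCongruencePrimes1999] Thm 1;
[PastenShimura2024] §3, Rem. 3.3.
-/

noncomputable section
namespace Summit.ABC.Analytic
open WeierstrassCurve NumberField
open Literature.NumberTheory.EllipticCurves Literature.NumberTheory.EllipticCurves.ModularForms

/-! ## §1 R5♯ ⟺ ABC (no named fact) -/

/-- **R5♯ ⇒ generalized Szpiro (Bombieri–Gubler's `max(|Δ_min|, |c₄|³) ≤ C(ε) N^{6+ε}`)**: from `h_F ≤ (½ + ε') log N + C`,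
`h_F = −½ log covol(Λ)` (PROVED `faltingsHeight_eq_neg_half_log_covolume`) and Silverman 1986
`max(|Δ|,|c₄|³) ≤ A_ε covol^{−(6+ε)}` on a global minimal model (PROVED `silverman1986_discriminant_c4_covolume_holds`).
Kernel certificate REF-B F7 (abc-an-ref-2). [cite: Silverman1986, Prop. 1.1 and Cor. 2.3] -/
theorem generalizedSzpiroBG_of_heightConjectureRat (h : HeightConjectureRat) :
    GeneralizedSzpiroConjectureBG := by
  intro ε hε
  obtain ⟨A, hA⟩ := silverman1986_discriminant_c4_covolume_holds (ε / 2) (by positivity)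
  obtain ⟨C, hC⟩ := h (ε / (2 * (12 + ε))) (by positivity)
  refine ⟨max A 0 * Real.exp ((12 + ε) * C), fun W₀ hell hmin => ?_⟩
  set W : WeierstrassCurve ℚ := W₀.baseChange ℚ with hWdef
  haveI := hell
  haveI : W.IsGloballyMinimal := isGloballyMinimal_of_forall_isMinimalAt_int W hmin
  obtain ⟨L, hL⟩ := exists_isNeronLatticeOf_holds (W.baseChange ℂ)
  have hcov : 0 < ZLattice.covolume L.lattice := ZLattice.covolume_pos L.lattice _
  have hh := W.faltingsHeight_eq_neg_half_log_covolume hL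
  have hN : (0 : ℝ) < (W.conductorNorm ℤ : ℝ) := by exact_mod_cast conductorNorm_pos_holds W
  have hW := hC W
  have hS := hA W L hL
  have hpow : ZLattice.covolume L.lattice ^ (-(6 + ε / 2)) =
      Real.exp ((12 + ε) * W.faltingsHeight) := by
    rw [Real.rpow_def_of_pos hcov, hh]
    congr 1
    ring
  have hexp : Real.exp ((12 + ε) * W.faltingsHeight) ≤
      Real.exp ((12 + ε) * C) * (W.conductorNorm ℤ : ℝ) ^ (6 + ε) := by
    have h1 : (12 + ε) * W.faltingsHeight ≤
        (12 + ε) * ((1 / 2 + ε / (2 * (12 + ε))) * Real.log (W.conductorNorm ℤ : ℝ) + C) :=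
      mul_le_mul_of_nonneg_left hW (by positivity)
    have h2 : (12 + ε) * ((1 / 2 + ε / (2 * (12 + ε))) * Real.log (W.conductorNorm ℤ : ℝ) + C) =
        (6 + ε) * Real.log (W.conductorNorm ℤ : ℝ) + (12 + ε) * C := by
      have hne : (2 * (12 + ε)) ≠ 0 := by positivity
      field_simp
      ring
    calc Real.exp ((12 + ε) * W.faltingsHeight)
        ≤ Real.exp ((6 + ε) * Real.log (W.conductorNorm ℤ : ℝ) + (12 + ε) * C) :=
          Real.exp_le_exp.mpr (h2 ▸ h1)
      _ = Real.exp ((12 + ε) * C) * (W.conductorNorm ℤ : ℝ) ^ (6 + ε) := by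
          rw [Real.exp_add, Real.rpow_def_of_pos hN, mul_comm (Real.log _) (6 + ε), mul_comm]
  have hΔ : W.Δ = (W₀.Δ : ℚ) := by
    rw [hWdef, baseChange, map_Δ]; exact eq_intCast _ _
  have hc₄ : W.c₄ = (W₀.c₄ : ℚ) := by
    rw [hWdef, baseChange, map_c₄]; exact eq_intCast _ _
  have hq : ((max |W₀.Δ| (|W₀.c₄| ^ 3) : ℤ) : ℝ) = ((max |W.Δ| (|W.c₄| ^ 3) : ℚ) : ℝ) := by
    rw [hΔ, hc₄]; push_cast; norm_cast
  have k1 : ((max |W.Δ| (|W.c₄| ^ 3) : ℚ) : ℝ) ≤ A * ZLattice.covolume L.lattice ^ (-(6 + ε / 2)) := hS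
  have k2 : A * ZLattice.covolume L.lattice ^ (-(6 + ε / 2)) ≤
      max A 0 * ZLattice.covolume L.lattice ^ (-(6 + ε / 2)) :=
    mul_le_mul_of_nonneg_right (le_max_left _ _) (Real.rpow_nonneg hcov.le _)
  have k3 : max A 0 * ZLattice.covolume L.lattice ^ (-(6 + ε / 2)) =
      max A 0 * Real.exp ((12 + ε) * W.faltingsHeight) := by rw [hpow]
  have k4 : max A 0 * Real.exp ((12 + ε) * W.faltingsHeight) ≤
      max A 0 * (Real.exp ((12 + ε) * C) * (W.conductorNorm ℤ : ℝ) ^ (6 + ε)) :=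
    mul_le_mul_of_nonneg_left hexp (le_max_right _ _)
  have key : ((max |W.Δ| (|W.c₄| ^ 3) : ℚ) : ℝ) ≤
      max A 0 * Real.exp ((12 + ε) * C) * (W.conductorNorm ℤ : ℝ) ^ (6 + ε) := by
    rw [mul_assoc]; exact (k1.trans k2).trans (k3.le.trans k4)
  rw [hq]
  exact key

/-- **R5♯ ⇒ ABC, unconditionally in the kernel** (no Petersson, no Manin, no modularity):
Frey's height conjecture for all `E/ℚ` is (at least) abc-strength — a RESTATEMENT row. Kernel certificate REF-B F7.
[cite: BombieriGubler2006, Thm. 12.5.12] [cite: Silverman1986, Cor. 2.3] -/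
theorem abc_of_heightConjectureRat (h : HeightConjectureRat) : ABC :=
  ABC_iff.mpr (abcLt_of_abcLe (abcLe_of_generalizedSzpiroBG
    (generalizedSzpiroBG_of_heightConjectureRat h)))

/-- **ABC ⇒ R5♯, unconditionally in the kernel**: abc ⇒ generalized Szpiro (Bombieri–Gubler
12.5.12 (a) ⇒ (c), PROVED) ⇒ `h ≤ (½+ε) log N + C` by Silverman 1986 `12 h ≤ log max(|Δ|,|c₄|³) − C₀`
(PROVED) on a global minimal model. Kernel certificate REF-B F7. [cite: BombieriGubler2006, Thm. 12.5.12] [cite: Silverman1986, Prop. 1.1] -/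
theorem heightConjectureRat_of_abc (habc : ABC) : HeightConjectureRat := by
  have hle : ∀ ε : ℝ, 0 < ε → ∃ C : ℝ, ∀ a b c : ℕ,
      Literature.NumberTheory.DiophantineGeometry.IsABCTriple a b c →
        (c : ℝ) ≤ C * ((Literature.NumberTheory.DiophantineGeometry.rad a b c : ℕ) : ℝ) ^ (1 + ε) := by
    intro ε hε
    obtain ⟨C, -, hC⟩ := (ABC_iff.mp habc) ε hε
    exact ⟨C, fun a b c h => (hC a b c h).le⟩
  have hS : GeneralizedSzpiroConjectureBG := abcLe_iff_generalizedSzpiroBG_holds.mp hle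
  obtain ⟨C₀, C₁, hSil⟩ := silverman1986_log_max_sub_height_holds
  intro ε hε
  obtain ⟨C, hC⟩ := hS (12 * ε) (by positivity)
  refine ⟨(Real.log (max C 1) - C₀) / 12, fun W _ => ?_⟩
  obtain ⟨V, hV⟩ := hasGlobalMinimalModel_rat_holds W
  haveI := hV
  rw [← faltingsHeight_smul W V, ← conductorNorm_smul_rat W V]
  set W' : WeierstrassCurve ℚ := V • W with hW'
  obtain ⟨L, hL⟩ := exists_isNeronLatticeOf_holds (W'.baseChange ℂ)
  have hh : W'.faltingsHeight = neronLatticeHeight L := by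
    rw [W'.faltingsHeight_eq_neg_half_log_covolume hL, neronLatticeHeight]
  have hlow := (hSil W' L hL).1
  set W₀ : WeierstrassCurve ℤ := integralModelInt W' with hW₀
  have hW₀W : W₀.baseChange ℚ = W' := baseChange_integralModelInt W'
  have hell : (W₀.baseChange ℚ).IsElliptic := by rw [hW₀W]; infer_instance
  have hmin : ∀ v : IsDedekindDomain.HeightOneSpectrum ℤ, (W₀.baseChange ℚ).IsMinimalAt v :=
    fun v => by rw [hW₀W]; exact IsGloballyMinimal.isMinimalAt_int W' v
  have hBG := hC W₀ hell hmin
  rw [hW₀W] at hBG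
  have hq : (max |W'.Δ| (|W'.c₄| ^ 3) : ℚ) = ((max |W₀.Δ| (|W₀.c₄| ^ 3) : ℤ) : ℚ) := by
    rw [← cast_integralModelInt_Δ W', ← cast_integralModelInt_c₄ W']
    push_cast
    rfl
  have hM : ((max |W'.Δ| (|W'.c₄| ^ 3) : ℚ) : ℝ) = ((max |W₀.Δ| (|W₀.c₄| ^ 3) : ℤ) : ℝ) := by
    rw [hq, Rat.cast_intCast]
  have hM1 : (1 : ℝ) ≤ ((max |W'.Δ| (|W'.c₄| ^ 3) : ℚ) : ℝ) := one_le_max_abs_Δ_c4 W'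
  have hN : (0 : ℝ) < (W'.conductorNorm ℤ : ℝ) := by exact_mod_cast conductorNorm_pos_holds W'
  have hC1 : (0 : ℝ) < max C 1 := lt_max_of_lt_right one_pos
  have hMle : ((max |W'.Δ| (|W'.c₄| ^ 3) : ℚ) : ℝ) ≤
      max C 1 * (W'.conductorNorm ℤ : ℝ) ^ (6 + 12 * ε) := by
    rw [hM]
    exact hBG.trans (mul_le_mul_of_nonneg_right (le_max_left _ _) (Real.rpow_nonneg hN.le _))
  have hlogM : Real.log ((max |W'.Δ| (|W'.c₄| ^ 3) : ℚ) : ℝ) ≤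
      Real.log (max C 1) + (6 + 12 * ε) * Real.log (W'.conductorNorm ℤ : ℝ) := by
    have := Real.log_le_log (by linarith) hMle
    rwa [Real.log_mul hC1.ne' (Real.rpow_pos_of_pos hN _).ne', Real.log_rpow hN] at this
  rw [hh]
  linarith

/-- **R5♯ ⟺ ABC** in the kernel: Frey's height conjecture `h ≤ (½+ε) log N + C_ε` for all `E/ℚ`
is an exact RESTATEMENT of the abc conjecture (not merely «abc-equivalent on Frey curves»). [cite: Frey1989] [cite: BombieriGubler2006, Thm. 12.5.12] -/
theorem abc_iff_heightConjectureRat : ABC ↔ HeightConjectureRat :=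
  ⟨heightConjectureRat_of_abc, abc_of_heightConjectureRat⟩


/-! ## A0-1 converse certificate (REF-B): abc ⇒ sharp degree conjecture over ALL `E/ℚ`,
modulo exactly three inputs — modularity (`nonempty_modularParametrizationData`, KNOWN named fact),
a general-level Petersson UPPER bound `(f,f) ≪_θ N^{1+θ}` (lens-4 `PeterssonUpperRat`, Mai–Murty /
Murty; squarefree level PROVED in tree) and UNIFORMLY BOUNDED Manin constants (lens-4 `PolyManinRat 0`,
OPEN off the semistable case). Route: abc ⇒ `HeightConjectureRat` (F7) ⇒ Frey–Zagier identity
`2h = log deg − log(4π² c² (f,f))`. So A0-1 `DegreeConjectureRat` is a RESTATEMENT of abc modulo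
{modularity, Petersson upper, PolyManin(0)} — and STRICTLY ≥ abc without them. -/


/-! ## §2 ABC ⇒ R1♯ modulo modularity, a Petersson UPPER bound and bounded Manin constants (Murty 1999 Thm 1 (ii)) -/

/-- REF-B certificate for census row A0-1: `ABC → DegreeConjectureRat` modulo modularity, a
general-level Petersson upper bound for every `θ > 0`, and uniformly bounded Manin constants. Kernel certificate REF-B F9 (abc-an-ref-2). [cite: MurtyCongruencePrimes1999, Thm. 1 (ii)] [cite: PastenShimura2024, Rem. 3.3] -/
theorem degreeConjectureRat_of_abc (hmod : nonempty_modularParametrizationData)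
    (hU : ∀ θ : ℝ, 0 < θ → PeterssonUpperRat θ) (hM : PolyManinRat 0) (habc : ABC) :
    DegreeConjectureRat := by
  intro ε hε
  obtain ⟨C₁, hC₁⟩ := heightConjectureRat_of_abc habc (ε / 4) (by positivity)
  obtain ⟨C₂, hC₂⟩ := hU (ε / 2) (by positivity)
  obtain ⟨M, hMc⟩ := hM
  refine ⟨4 * Real.pi ^ 2 * (max M 0) ^ 2 * max C₂ 0 * Real.exp (2 * C₁), fun W _ _ _ => ?_⟩
  obtain ⟨D, hD⟩ := hMc W (hmod W)
  refine ⟨D, ?_⟩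
  set N : ℕ := W.conductorNorm ℤ with hNdef
  have hN1 : (1 : ℝ) ≤ (N : ℝ) := by
    have : N ≠ 0 := NeZero.ne N
    exact_mod_cast Nat.one_le_iff_ne_zero.mpr this
  have hN0 : (0 : ℝ) < (N : ℝ) := by linarith
  -- the three inputs at this curve
  have hh : W.faltingsHeight ≤ (1 / 2 + ε / 4) * Real.log (N : ℝ) + C₁ := hC₁ W
  have hP : (peterssonProduct (CongruenceSubgroup.Gamma0 N) 2 D.f D.f).re ≤
      max C₂ 0 * (N : ℝ) ^ (1 + ε / 2) :=
    (hC₂ N W D.f D.isNewformOf).trans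
      (mul_le_mul_of_nonneg_right (le_max_left _ _) (by positivity))
  have hPpos : 0 < (peterssonProduct (CongruenceSubgroup.Gamma0 N) 2 D.f D.f).re :=
    D.isNewformOf.peterssonProduct_re_pos
  have hc : |(D.maninConstant : ℝ)| ≤ max M 0 := by
    have := hD; rw [Real.rpow_zero, mul_one] at this; exact this.trans (le_max_left _ _)
  have hc2 : (D.maninConstant : ℝ) ^ 2 ≤ (max M 0) ^ 2 := by
    rw [← sq_abs]; exact pow_le_pow_left₀ (abs_nonneg _) hc 2
  -- Frey–Zagier: deg = exp(2h) · 4π² c² (f,f)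
  have hZ := D.two_mul_faltingsHeight_eq
  have hdegpos : (0 : ℝ) < (D.modularDegree : ℝ) := by exact_mod_cast D.deg_pos
  set X : ℝ := 4 * Real.pi ^ 2 * (D.maninConstant : ℝ) ^ 2 *
      (peterssonProduct (CongruenceSubgroup.Gamma0 N) 2 D.f D.f).re with hXdef
  have hc0 : (D.maninConstant : ℝ) ≠ 0 := by exact_mod_cast D.maninConstant_ne_zero_holds
  have hXpos : 0 < X := by positivity
  have hdeg_eq : (D.modularDegree : ℝ) = Real.exp (2 * W.faltingsHeight) * X := by
    rw [hZ, Real.exp_sub, Real.exp_log hdegpos, Real.exp_log hXpos, div_mul_cancel₀ _ hXpos.ne']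
  -- bound each factor
  have hexp : Real.exp (2 * W.faltingsHeight) ≤ (N : ℝ) ^ (1 + ε / 2) * Real.exp (2 * C₁) := by
    have h2 : 2 * W.faltingsHeight ≤ (1 + ε / 2) * Real.log (N : ℝ) + 2 * C₁ := by linarith
    calc Real.exp (2 * W.faltingsHeight) ≤ Real.exp ((1 + ε / 2) * Real.log (N : ℝ) + 2 * C₁) :=
          Real.exp_le_exp.mpr h2
      _ = (N : ℝ) ^ (1 + ε / 2) * Real.exp (2 * C₁) := by
          rw [Real.exp_add, Real.rpow_def_of_pos hN0, mul_comm (Real.log _)]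
  have hX : X ≤ 4 * Real.pi ^ 2 * (max M 0) ^ 2 * (max C₂ 0 * (N : ℝ) ^ (1 + ε / 2)) := by
    rw [hXdef]
    exact mul_le_mul (mul_le_mul_of_nonneg_left hc2 (by positivity)) hP hPpos.le (by positivity)
  have hNN : (N : ℝ) ^ (1 + ε / 2) * (N : ℝ) ^ (1 + ε / 2) = (N : ℝ) ^ (2 + ε) := by
    rw [← Real.rpow_add hN0]; ring_nf
  calc (D.modularDegree : ℝ) = Real.exp (2 * W.faltingsHeight) * X := hdeg_eq
    _ ≤ ((N : ℝ) ^ (1 + ε / 2) * Real.exp (2 * C₁)) *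
          (4 * Real.pi ^ 2 * (max M 0) ^ 2 * (max C₂ 0 * (N : ℝ) ^ (1 + ε / 2))) :=
        mul_le_mul hexp hX hXpos.le (by positivity)
    _ = 4 * Real.pi ^ 2 * (max M 0) ^ 2 * max C₂ 0 * Real.exp (2 * C₁) * (N : ℝ) ^ (2 + ε) := by
        rw [← hNN]; ring


/-- **R1♯ ⟺ ABC modulo the known-type inputs**: the sharp degree conjecture for all `E/ℚ` is a RESTATEMENT of abc granted
the Petersson `1−ε` lower bound (Hoffstein–Lockhart, NAMED FACT), modularity (NAMED FACT), a general-level Petersson upper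
bound for every `θ > 0` and uniformly bounded Manin constants (`PolyManinRat 0`; Česnavičius 2018 for semistable optimal
curves, OPEN in general) — Murty 1999 Thm 1 with Pasten's Manin-constant caveat (Rem. 3.3), for all `E/ℚ` rather than Frey
curves. [cite: MurtyCongruencePrimes1999, Thm. 1] [cite: PastenShimura2024, Rem. 3.3] -/
theorem abc_iff_degreeConjectureRat_of_facts (hP : murty_petersson_newform_lower_bound)
    (hmod : nonempty_modularParametrizationData) (hU : ∀ θ : ℝ, 0 < θ → PeterssonUpperRat θ) (hM : PolyManinRat 0) :
    ABC ↔ DegreeConjectureRat :=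
  ⟨degreeConjectureRat_of_abc hmod hU hM, abc_of_degreeConjectureRat hP⟩

/-- **R1♯ ⟺ R5♯ modulo the same inputs** (Frey 1989 / Mai–Murty 1994: "degree conjecture ⇔ height conjecture", the
`⇐` direction needing the Manin bound). [cite: MaiMurty1994] [cite: PastenShimura2024, Rem. 3.3] -/
theorem degreeConjectureRat_iff_heightConjectureRat_of_facts (hP : murty_petersson_newform_lower_bound)
    (hmod : nonempty_modularParametrizationData) (hU : ∀ θ : ℝ, 0 < θ → PeterssonUpperRat θ) (hM : PolyManinRat 0) :
    DegreeConjectureRat ↔ HeightConjectureRat :=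
  ⟨heightConjectureRat_of_degreeConjectureRat hP,
    fun h => degreeConjectureRat_of_abc hmod hU hM (abc_of_heightConjectureRat h)⟩


/-! ## §3 Polynomial level: Pasten's Conj. 3.2 ⟺ Conj. 3.1 modulo Manin and Petersson-upper -/

/-- **R1 ⟺ R5 at the polynomial level** (`∃ K, PolyModularDegreeRat K` ↔ `∃ K, PolyFaltingsHeightRat K`, i.e. Pasten 2024
Conj. 3.2 ⟺ Conj. 3.1), modulo modularity, a Petersson upper bound `PeterssonUpperRat θ` (known in print) and a POLYNOMIAL
Manin bound `PolyManinRat μ` (the converse's extra input, Pasten Rem. 3.3): `⇒` is file I's hypothesis-free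
`polyFaltingsHeightRat_of_polyModularDegreeRat` (`K ↦ K/2`), `⇐` is file II's converse (`K ↦ 2K + 2μ + 1 + θ`).
[cite: PastenShimura2024, Conj. 3.1, Conj. 3.2 and Rem. 3.3] [cite: MaiMurty1994] -/
theorem exists_polyModularDegreeRat_iff_exists_polyFaltingsHeightRat_of_facts {μ θ : ℝ}
    (hmod : nonempty_modularParametrizationData) (hM : PolyManinRat μ) (hU : PeterssonUpperRat θ) :
    (∃ K : ℝ, PolyModularDegreeRat K) ↔ ∃ K : ℝ, PolyFaltingsHeightRat K :=
  ⟨fun ⟨K, h⟩ => ⟨K / 2, polyFaltingsHeightRat_of_polyModularDegreeRat h⟩,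
    fun ⟨_, h⟩ => ⟨_, polyModularDegreeRat_of_polyFaltingsHeightRat_of_manin_of_petersson hmod h hM hU⟩⟩

/-- **Either polynomial row gives A-PS by name** (`Summit.ABC.PolySzpiroRat`), hypothesis-free — the cell's kernel statement
in its `∃ K` form: Pasten 2024 Conj. 3.2 ⇒ Conj. 1.1 and Conj. 3.1 ⇒ Conj. 1.1. NOT abc. [cite: PastenShimura2024, §3 (3.1)–(3.2)] -/
theorem polySzpiroRat_of_exists_row
    (h : (∃ K : ℝ, PolyModularDegreeRat K) ∨ ∃ K : ℝ, PolyFaltingsHeightRat K) : Summit.ABC.PolySzpiroRat :=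
  h.elim (fun ⟨_, hK⟩ => polySzpiroRat_of_polyModularDegreeRat hK) fun ⟨_, hK⟩ => polySzpiroRat_of_polyFaltingsHeightRat hK

end Summit.ABC.Analytic
end
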